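import Summits.QuantumAdvantage.QuantumAdvantage.Theorems.LinnikCubicClassGroupsDegreeOnePrimesEscapeCubicChebotarevInputs
import Summits.QuantumAdvantage.QuantumAdvantage.Theorems.LinnikCubicClassGroupsDegreeOnePrimesEscapeCubicSplittingTheta
import Summits.QuantumAdvantage.QuantumAdvantage.Theorems.LinnikCubicClassGroupsDegreeOnePrimesEscapeCubicClosure
import Literature.NumberTheory.NumberFields.PureCubicGenusDivisorLemmas
import Mathlib.NumberTheory.Cyclotomic.Basic
import HarnessLib

/-!
# The least inert prime of a pure cubic field is `≤ |d_K|^L`, unconditionally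

Topic `Summits/QuantumAdvantage/QuantumAdvantage/Theorems`, cell B2b-1 (linnik-cubic), PART A (gen 7);
helper toward the crux `DegreeOnePrimesEscape` (stmt-QuantumAdvantage-11543) of route
`LinnikCubicClassGroups`.  HONEST FRAMING: the value of this file is a THEOREM (kernel-checked, GRH-free,
Siegel-free, no hypothesis) — NOT summit progress (the route still rests on the hypothesis-type target
`PureCubicClassNumberHard`).

**Theorem** (`exists_inertPrime_le_of_cubeRoot`).  There is an absolute `L > 0` such that for every
natural number `m` that is not the cube of a rational and every cubic number field `K` containing a cube
root of `m` (i.e. `K ≅ ℚ(∛m)`), some rational prime `p ≤ |d_K|^{L}` is INERT in `K`: `p𝓞_K` is a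
prime ideal.  Equivalently: the least prime `p ≡ 1 (mod 3)` for which `m` is not a cube modulo `p` is
`≪ |d_K|^{L}`.

This is the Chebotarev–Linnik theorem of Lagarias–Montgomery–Odlyzko [LagariasMontgomeryOdlyzko1979]
(least prime in a conjugacy class `≪ |d_N|^{c}`) for the class of 3-cycles of `Gal(N/ℚ) ≅ S₃`,
`N = K(ζ₃)`, the first NON-abelian Frobenius class treated in the tree — proved here without Artin
`L`-functions, by counting splitting types in `N ⊃ K, k = ℚ(ζ₃)`:
`3·Σ_{p ≤ x inert in K} log p ≥ θ(x) + θ¹_k(x) − θ¹_K(x) − 3 log|d_N|` (`three_mul_inertSum_ge`), with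
`θ_K(x) ≤ 1.1 x` UNIFORMLY for `x ≥ Q_K^{a}` (`chebyshevThetaIdeal_le_uniform`, from the
Deuring–Heilbronn class prime number theorem of PART A), `θ¹_k(x), θ(x) ≥ 0.9 x` for the FIXED fields
`k ≅ ℚ(ζ₃)` and `ℚ` (Landau), and `|d_N| ≤ |d_K|^{A}` (`stub_cubicClosure`).  For a general
non-Galois cubic field the quadratic resolvent `k = ℚ(√d_K)` varies and a possible exceptional zero of
`L(s, χ_{d_K})` calls for the relative-error prime number theorem of `N` keyed to that zero; not done here.

Placement (presearch 2026-08-19): the statement is KNOWN in print with explicit exponents — Lagarias–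
Montgomery–Odlyzko 1979 (`p ≪ d_N^{c}`), Cho–Kim (sign changes of modular/Maass forms: `α(S₃,[(123)]) =
3/16`, resp. `1/4 − δ`) and P. J. Cho, R. J. Lemke Oliver, A. Zaman, *The least prime with a given cycle
type*, arXiv:2512.24963 (2025, zero-free method, all `S_n`).  What is new here is only the KERNEL-CHECKED
proof, by the classical zero-density/Deuring–Heilbronn route of this cell, with an inexplicit exponent.

References: J. C. Lagarias, H. L. Montgomery, A. M. Odlyzko, Invent. Math. 54 (1979) 271–296
[LagariasMontgomeryOdlyzko1979]; J. Thorner, A. Zaman, Algebra Number Theory 13 (2019) [ThornerZaman2019];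
A. Weiss, J. reine angew. Math. 338 (1983) [Weiss1983].
-/

noncomputable section

open scoped NumberField nonZeroDivisors IntermediateField
open Finset Real Ideal NumberField Polynomial
open Literature.NumberTheory.NumberFields Literature.NumberTheory.LFunctions
  Literature.NumberTheory.LFunctions.NumberField

namespace Summit.QuantumAdvantage.QuantumAdvantage.Theorems.DegreeOnePrimesEscape

/-! ### A primitive cube root of unity in the Galois closure of `ℚ(∛m)` -/

/-- **In a Galois number field containing a cube root of a non-cube `m` there is a primitive cube
root of unity** (the minimal polynomial `X³ − m` splits into three distinct roots, whose ratios are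
cube roots of unity). Adapted from the tree's `Honda1971.pow_three_ne_natCast_of_isGalois`. -/
theorem exists_isPrimitiveRoot_three_of_cube_eq {N : Type*} [Field N] [NumberField N] [IsGalois ℚ N]
    {m : ℕ} (hm : ∀ b : ℚ, b ^ 3 ≠ (m : ℚ)) {γ : N} (hγ : γ ^ 3 = (m : N)) :
    ∃ ω : N, IsPrimitiveRoot ω 3 := by
  classical
  have hm0 : (m : N) ≠ 0 := by
    intro h
    have : (m : ℚ) = 0 := by exact_mod_cast (show (m : ℕ) = 0 by exact_mod_cast h)
    exact hm 0 (by rw [this]; norm_num)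
  have hγ0 : γ ≠ 0 := by
    rintro rfl
    exact hm0 (by rw [← hγ]; norm_num)
  have hirr : Irreducible (X ^ 3 - C (m : ℚ) : ℚ[X]) :=
    X_pow_sub_C_irreducible_of_prime Nat.prime_three hm
  have hmin : minpoly ℚ γ = X ^ 3 - Polynomial.C (m : ℚ) := by
    refine (minpoly.eq_of_irreducible_of_monic hirr ?_ (monic_X_pow_sub_C _ (by norm_num))).symm
    simp [hγ]
  have hsplit : ((X ^ 3 - Polynomial.C (m : ℚ) : ℚ[X]).map (algebraMap ℚ N)).Splits :=
    hmin ▸ Normal.splits inferInstance γ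
  have hmapeq : ((X ^ 3 - Polynomial.C (m : ℚ) : ℚ[X]).map (algebraMap ℚ N)) =
      X ^ 3 - Polynomial.C (m : N) := by
    simp [Polynomial.map_sub, Polynomial.map_pow]
  rw [hmapeq] at hsplit
  have hf0 : (X ^ 3 - Polynomial.C (m : N) : N[X]) ≠ 0 := X_pow_sub_C_ne_zero (by norm_num) _
  have hcard : (X ^ 3 - Polynomial.C (m : N) : N[X]).roots.card = 3 := by
    have h := hsplit.natDegree_eq_card_roots
    rw [natDegree_X_pow_sub_C] at h
    exact h.symm
  have hsep : (X ^ 3 - Polynomial.C (m : N) : N[X]).Separable :=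
    separable_X_pow_sub_C (m : N) (by norm_num) hm0
  have hnodup : (X ^ 3 - Polynomial.C (m : N) : N[X]).roots.Nodup := nodup_roots hsep
  obtain ⟨γ', hγ'mem, hne⟩ : ∃ γ' ∈ (X ^ 3 - Polynomial.C (m : N) : N[X]).roots, γ' ≠ γ := by
    by_contra h
    push Not at h
    have hsub : (X ^ 3 - Polynomial.C (m : N) : N[X]).roots.toFinset ⊆ {γ} := fun x hx =>
      Finset.mem_singleton.mpr (h x (Multiset.mem_toFinset.mp hx))
    have := Finset.card_le_card hsub
    rw [Multiset.toFinset_card_of_nodup hnodup, hcard, Finset.card_singleton] at this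
    omega
  have hγ'3 : γ' ^ 3 = (m : N) := by
    rw [mem_roots hf0, IsRoot.def] at hγ'mem
    simpa [sub_eq_zero] using hγ'mem
  set ω : N := γ' / γ with hωdef
  have hω3 : ω ^ 3 = 1 := by
    rw [hωdef, div_pow, hγ'3, hγ, div_self hm0]
  have hω1 : ω ≠ 1 := by
    intro h
    rw [hωdef, div_eq_one_iff_eq hγ0] at h
    exact hne h
  have hω2 : ω ^ 2 ≠ 1 := by
    intro h
    apply hω1
    have : ω ^ 3 = ω * ω ^ 2 := by ring
    rw [this, h, mul_one] at hω3
    exact hω3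
  refine ⟨ω, IsPrimitiveRoot.mk_of_lt ω (by norm_num) hω3 ?_⟩
  intro l hl0 hl3
  interval_cases l
  · simpa using hω1
  · exact hω2

/-- **The cyclotomic quadratic subfield**: a number field containing a primitive cube root of unity
`ω` contains the quadratic subfield `ℚ(ω) ≅ ℚ(ζ₃) = ℚ(√−3)`. -/
theorem exists_quadratic_cyclotomic_subfield {N : Type*} [Field N] [NumberField N] {ω : N}
    (hω : IsPrimitiveRoot ω 3) :
    ∃ k : IntermediateField ℚ N, Module.finrank ℚ k = 2 ∧ Nonempty (k ≃ₐ[ℚ] CyclotomicField 3 ℚ) := by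
  haveI hcyc : IsCyclotomicExtension {3} ℚ ℚ⟮ω⟯ := hω.intermediateField_adjoin_isCyclotomicExtension ℚ
  -- `Algebra ℚ (CyclotomicField 3 ℚ)` is found as `DivisionRing.toRatAlgebra`; realign the instance
  haveI hI : IsCyclotomicExtension {3} ℚ (CyclotomicField 3 ℚ) :=
    CyclotomicField.isCyclotomicExtension 3 ℚ
  have hint : IsIntegral ℚ ω := .of_finite ℚ ω
  refine ⟨ℚ⟮ω⟯, ?_, ⟨IsCyclotomicExtension.algEquiv {3} ℚ ℚ⟮ω⟯ (CyclotomicField 3 ℚ)⟩⟩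
  rw [IntermediateField.adjoin.finrank hint, ← cyclotomic_eq_minpoly_rat hω (by norm_num),
    natDegree_cyclotomic, Nat.totient_prime Nat.prime_three]

/-! ### The counting core -/

/-- **Core**: for the `S₃`-data `N ⊃ K', k` and an `x` with `θ(x) ≥ 0.9 x`, `θ¹_k(x) ≥ 0.9 x`,
`θ_{K'}(x) ≤ 1.1 x` and `3 log|d_N| < 0.7 x`, some prime `p ≤ x` with `p ∤ d_N` has no degree-one
prime of `K'` above it. -/
theorem exists_noDegOne_of_bounds {N : Type*} [Field N] [NumberField N] [IsGalois ℚ N]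
    (h6 : Module.finrank ℚ N = 6) (hna : ∃ g h : N ≃ₐ[ℚ] N, g * h ≠ h * g)
    (K' k : IntermediateField ℚ N) (hK' : Module.finrank ℚ K' = 3) (hk : Module.finrank ℚ k = 2)
    {x : ℝ} (hθ : 9 / 10 * x ≤ Chebyshev.theta x) (hθk : 9 / 10 * x ≤ degreeOneTheta k x)
    (hθK : chebyshevThetaIdeal K' x ≤ 11 / 10 * x)
    (hlog : 3 * Real.log ((NumberField.discr N).natAbs : ℝ) < 7 / 10 * x) :
    ∃ p : ℕ, p.Prime ∧ (p : ℝ) ≤ x ∧ ¬ ((p : ℤ) ∣ NumberField.discr N) ∧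
      (splittingType K' p).count 1 = 0 := by
  classical
  have hsum := three_mul_inertSum_ge h6 hna K' k hK' hk x
  have hK1 := degreeOneTheta_le_chebyshevThetaIdeal K' x
  have hpos : 0 < ∑ p ∈ (Nat.primesLE ⌊x⌋₊).filter
      (fun p : ℕ => ¬ ((p : ℤ) ∣ NumberField.discr N) ∧ (splittingType K' p).count 1 = 0),
      Real.log p := by
    linarith
  obtain ⟨p, hp, hpx, hP⟩ := exists_prime_of_sum_log_pos hpos
  exact ⟨p, hp, hpx, hP.1, hP.2⟩

/-! ### The theorem -/

/-- `Q_K ≤ |d_K|^4` for a cubic field. -/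
theorem condQn_le_discr_pow_four (K : Type) [Field K] [NumberField K] (h3 : Module.finrank ℚ K = 3) :
    ThornerZaman.condQn K ≤ ((NumberField.discr K).natAbs : ℝ) ^ (4 : ℝ) := by
  have h := condQn_le_natAbs_discr_rpow K (by rw [h3]; norm_num)
  rw [h3] at h
  have hlog3 : Real.log 3 ≠ 0 := (Real.log_pos (by norm_num)).ne'
  have e : (1 : ℝ) + ((3 : ℕ) : ℝ) * Real.log ((3 : ℕ) : ℝ) / Real.log 3 = 4 := by
    push_cast; field_simp; ring
  rwa [e] at h

/-- **The least inert prime of a pure cubic field, unconditionally**: there is `L > 0` such that for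
every `m ∈ ℕ` that is not a rational cube and every cubic number field `K ∋ ∛m`, some rational prime
`p ≤ |d_K|^{L}` generates a PRIME ideal `p𝓞_K` (`p` is inert in `K`; equivalently `p ≡ 1 (mod 3)` and
`m` is not a cube modulo `p`).  GRH-free, Siegel-free, no hypothesis.
[cite: LagariasMontgomeryOdlyzko1979, Theorem 1.1 (least prime in a Chebotarev class, there `≪ d_L^{c}`)]
[cite: Weiss1983, Theorem 5.2] -/
theorem exists_inertPrime_le_of_cubeRoot :
    ∃ L : ℝ, 0 < L ∧ ∀ (m : ℕ), (∀ b : ℚ, b ^ 3 ≠ (m : ℚ)) →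
      ∀ (K : Type) [Field K] [NumberField K], Module.finrank ℚ K = 3 → ∀ α : K, α ^ 3 = (m : K) →
        ∃ p : ℕ, p.Prime ∧ (p : ℝ) ≤ ((NumberField.discr K).natAbs : ℝ) ^ L ∧
          (Ideal.span {(p : 𝓞 K)}).IsPrime := by
  classical
  obtain ⟨a, ha1, hup⟩ := chebyshevThetaIdeal_le_uniform 3 (by norm_num) (η := 1 / 10) (by norm_num)
  obtain ⟨x₀, hx₀2, hθQ⟩ := chebyshevTheta_eventually_ge (η := 1 / 10) (by norm_num)
  obtain ⟨x₁, hx₁2, hθk⟩ := degreeOneTheta_eventually (CyclotomicField 3 ℚ) (η := 1 / 10) (by norm_num)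
  obtain ⟨A, hclos⟩ := stub_cubicClosure
  -- the exponent
  set M : ℝ := max (max x₀ x₁) (5 * A + 1) with hM
  have hM2 : 2 ≤ M := le_trans hx₀2 (le_trans (le_max_left _ _) (le_max_left _ _))
  have hM0 : 0 < M := by linarith
  set ℓ : ℝ := Real.logb 3 M with hℓ
  have hℓ0 : 0 ≤ ℓ := Real.logb_nonneg (by norm_num) (by linarith)
  refine ⟨4 * a + 1 + ℓ, by positivity, fun m hm K _ _ h3 α hα => ?_⟩
  -- the closure
  have hKng : ¬ IsGalois ℚ K := fun hG =>
    Honda1971.pow_three_ne_natCast_of_isGalois (E := K) h3 hm α hα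
  obtain ⟨N, _, _, hGal, h6, hna, ⟨K', ⟨e⟩⟩, -, hdN⟩ := hclos K h3 hKng
  haveI := hGal
  have hK' : Module.finrank ℚ K' = 3 := by rw [← e.toLinearEquiv.finrank_eq, h3]
  -- the cube root of unity and the cyclotomic quadratic subfield
  have hγ : ((e α : K') : N) ^ 3 = (m : N) := by
    have h1 : (e α) ^ 3 = (m : K') := by rw [← map_pow, hα, map_natCast]
    have h2 := congrArg (fun z : K' => (z : N)) h1
    simpa using h2
  obtain ⟨ω, hω⟩ := exists_isPrimitiveRoot_three_of_cube_eq hm hγ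
  obtain ⟨k, hk, ⟨ek⟩⟩ := exists_quadratic_cyclotomic_subfield hω
  -- sizes
  set d : ℝ := ((NumberField.discr K).natAbs : ℝ) with hd
  have hK1 : 1 < Module.finrank ℚ K := by rw [h3]; norm_num
  have hd3 : (3 : ℝ) ≤ d := by
    have h2 := NumberField.abs_discr_gt_two hK1
    rw [hd, Nat.cast_natAbs]
    exact_mod_cast (show (3 : ℤ) ≤ |NumberField.discr K| by omega)
  have hd1 : (1 : ℝ) ≤ d := by linarith
  have hd0 : (0 : ℝ) < d := by linarith
  set x : ℝ := d ^ (4 * a + 1 + ℓ) with hx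
  have hsplitx : x = d ^ (4 * a) * d * d ^ ℓ := by
    rw [hx, Real.rpow_add hd0, Real.rpow_add hd0, Real.rpow_one]
  have hda : 1 ≤ d ^ (4 * a) := Real.one_le_rpow hd1 (by linarith)
  have hdℓ : M ≤ d ^ ℓ := by
    calc M = (3 : ℝ) ^ ℓ := by rw [hℓ, Real.rpow_logb (by norm_num) (by norm_num) hM0]
      _ ≤ d ^ ℓ := Real.rpow_le_rpow (by norm_num) hd3 hℓ0
  have hxM : M ≤ x := by
    rw [hsplitx]
    calc M ≤ d ^ ℓ := hdℓ
      _ = 1 * 1 * d ^ ℓ := by ring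
      _ ≤ d ^ (4 * a) * d * d ^ ℓ := by
          apply mul_le_mul (mul_le_mul hda hd1 zero_le_one (by linarith)) le_rfl (by linarith)
          positivity
  have hxdM : d * M ≤ x := by
    rw [hsplitx]
    calc d * M ≤ d * d ^ ℓ := mul_le_mul_of_nonneg_left hdℓ hd0.le
      _ = 1 * (d * d ^ ℓ) := by ring
      _ ≤ d ^ (4 * a) * (d * d ^ ℓ) := mul_le_mul_of_nonneg_right hda (by positivity)
      _ = d ^ (4 * a) * d * d ^ ℓ := by ring
  have hx₀ : x₀ ≤ x := le_trans (le_trans (le_max_left _ _) (le_max_left _ _)) hxM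
  have hx₁ : x₁ ≤ x := le_trans (le_trans (le_max_right _ _) (le_max_left _ _)) hxM
  -- `x ≥ Q_{K'}^a`
  have hdisc' : NumberField.discr K' = NumberField.discr K := (NumberField.discr_eq_discr_of_algEquiv K e).symm
  have hQ' : ThornerZaman.condQn K' ^ a ≤ x := by
    have hQ4 := condQn_le_discr_pow_four K' hK'
    rw [hdisc'] at hQ4
    have hQ12 : (12 : ℝ) ≤ ThornerZaman.condQn K' :=
      ThornerZaman.twelve_le_condQn (K := K') (by rw [hK']; norm_num)
    calc ThornerZaman.condQn K' ^ a ≤ (d ^ (4 : ℝ)) ^ a :=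
          Real.rpow_le_rpow (by linarith) hQ4 (by linarith)
      _ = d ^ (4 * a) := by rw [← Real.rpow_mul hd0.le]
      _ = d ^ (4 * a) * 1 * 1 := by ring
      _ ≤ d ^ (4 * a) * d * d ^ ℓ := by
          apply mul_le_mul (mul_le_mul_of_nonneg_left hd1 (by linarith)) (Real.one_le_rpow hd1 hℓ0)
            zero_le_one
          positivity
      _ = x := hsplitx.symm
  -- the four analytic inputs at `x`
  have h1 : 9 / 10 * x ≤ Chebyshev.theta x := by
    have := hθQ x hx₀; norm_num at this ⊢; linarith
  have h2 : 9 / 10 * x ≤ degreeOneTheta k x := by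
    rw [degreeOneTheta_eq_of_algEquiv ek]
    have := (hθk x hx₁).1; norm_num at this ⊢; linarith
  have h3' : chebyshevThetaIdeal K' x ≤ 11 / 10 * x := by
    have := hup K' hK' x hQ'; norm_num at this ⊢; linarith
  have h4 : 3 * Real.log ((NumberField.discr N).natAbs : ℝ) < 7 / 10 * x := by
    have hdN1 : (1 : ℝ) ≤ ((NumberField.discr N).natAbs : ℝ) := by
      have h1 := Int.one_le_abs (NumberField.discr_ne_zero N)
      rw [Int.abs_eq_natAbs] at h1
      exact_mod_cast h1
    have hlogN : Real.log ((NumberField.discr N).natAbs : ℝ) ≤ A * Real.log d := by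
      rw [← Real.log_pow]
      refine Real.log_le_log (by linarith) ?_
      rw [hd]; exact_mod_cast hdN
    have hlogd : Real.log d ≤ d := (Real.log_le_sub_one_of_pos hd0).trans (by linarith)
    have hA0 : (0 : ℝ) ≤ A := Nat.cast_nonneg A
    have hAM : 5 * (A : ℝ) + 1 ≤ M := le_max_right _ _
    have : 3 * ((A : ℝ) * Real.log d) ≤ 3 * A * d := by nlinarith
    nlinarith
  -- the prime
  obtain ⟨p, hp, hpx, hpN, hcount⟩ := exists_noDegOne_of_bounds h6 hna K' k hK' hk h1 h2 h3' h4
  refine ⟨p, hp, hpx, ?_⟩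
  have hcountK : (splittingType K p).count 1 = 0 := by
    rw [ArithmeticallyEquivalent.of_algEquiv e p hp]; exact hcount
  have hdvd : ¬ ((p : ℤ) ∣ NumberField.discr K) := fun h =>
    hpN (h.trans (hdisc' ▸ NumberField.discr_dvd_discr K' N))
  exact isPrime_span_of_count_one_eq_zero h3 hp hdvd hcountK

end Summit.QuantumAdvantage.QuantumAdvantage.Theorems.DegreeOnePrimesEscape

end
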